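import Literature.Geometry.Symplectic.JHolomorphicLaplacian
import HarnessLib

/-!
# `Δẽ ≥ -A ẽ²` for the tamed energy density `ẽ = ω(∂_s u, ∂_t u)` of a `J`-holomorphic map

Topic `Literature/Geometry/Symplectic`, sequel to `JHolomorphicLaplacian.lean` (flat vocabulary:
`u : ℂ → F`, `J : F → L(F)`, `∂_t u = J(u) ∂_s u`, `∂_s = D(·)(1)`, `∂_t = D(·)(i)`). There the
differential inequality `Δe ≥ -A e²` of McDuff–Salamon (2012), proof of Lemma 4.3.1, is proved
for the EUCLIDEAN energy density `e = |∂_s u|² + |∂_t u|²` of a chart. On a manifold the natural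
density is the integrand of the energy `E(u) = ∫ u^*ω`, i.e. `ẽ = ω(∂_s u, ∂_t u)` — a function on
the DOMAIN of `u`, independent of charts, which in a chart reads `ẽ(y) = Ω(u y)(∂_s u(y), ∂_t u(y))`
for the matrix field `Ω` of `ω`. This file proves the same inequality for `ẽ`, with a constant
depending only on `C²` bounds for `Ω` and `J` at the point `u z` and on the taming constant
`κ` (`Ω(x)(v, J(x)v) ≥ κ|v|²`):

* `laplacian_tamedDensity_ge` — **`Δẽ(z) ≥ -((11 + 35/κ) M⁸/κ²) ẽ(z)²`** when
  `‖Ω‖, ‖DΩ‖, ‖D²Ω‖, ‖J‖, ‖DJ‖, ‖D²J‖ ≤ M` at `u z` (`M ≥ 1`) — the pointwise input of the mean value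
  inequality (McDuff–Salamon, Lemma 4.3.1) via the Heinz trick
  (`Literature.Analysis.PDE.heinz_trick`), in the chart-independent form needed for curves in a
  compact almost complex manifold (constants uniform over a finite atlas);
* the Leibniz calculus used: `fderiv_bilinApply`, `norm_fderiv_bilinApply_le`,
  `fderiv_fderiv_bilinApply` (nine-term second derivative of `B(y)(p(y), q(y))`),
  `norm_fderiv_comp_apply_le_opNorm`, `norm_fderiv_fderiv_comp_apply_le` (chain rule bounds for
  `Ω ∘ u`), `fderiv_partial_t_eq` (`∂_h∂_t u = J(u)∂_h∂_s u + DJ(u)[∂_h u]∂_s u`), and the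
  real-arithmetic core `tamed_arith` / `amgm_tamed_aux`.

Proof of the inequality: expand `Δ[Ω(u)(∂_s u, ∂_t u)]`; the good term
`2 Σ_h Ω(∂_h∂_s u, ∂_h∂_t u) = 2 Σ_h Ω(∂_h∂_s u, J ∂_h∂_s u) + O(|du|²|∇∂_s u|) ≥ 2κ|∇∂_s u|² - …`
(taming) absorbs every mixed term; the third-order terms `Ω(Δ∂_s u, ∂_t u)`, `Ω(∂_s u, Δ∂_t u)` are
controlled through `Δ∂_k u = ∂_k Δu` and the quadratic formula
`Δu = DJ(u)[∂_t u]∂_s u - DJ(u)[∂_s u]∂_t u` (`laplacian_eq_of_jHolomorphic_nhds`).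

Everything is proved; no definitions, no named facts.

## References

* D. McDuff, D. Salamon, *J-holomorphic Curves and Symplectic Topology*, 2nd ed., AMS
  Colloquium Publ. 52 (2012), §4.3, Lemma 4.3.1 and its proof; §2.2 (the energy
  `E(u) = ∫ u^*ω`). [McDuffSalamon2012]
-/

noncomputable section

-- nested operator types `F →L[ℝ] F →L[ℝ] F →L[ℝ] ℝ`
set_option maxSynthPendingDepth 3

open scoped Topology ContDiff
open Set Filter Complex

namespace Literature.Geometry.Symplectic

/-! ### Leibniz calculus -/

section Generic

variable {G H : Type*} [NormedAddCommGroup G] [NormedSpace ℝ G] [NormedAddCommGroup H]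
  [NormedSpace ℝ H]


/-- differentiability of a partial derivative of a `C²` map at the point. [folklore] -/
theorem differentiableAt_fderiv_apply_const {f : ℂ → H} {z : ℂ} (hf : ContDiffAt ℝ 2 f z)
    (h : ℂ) : DifferentiableAt ℝ (fun y ↦ fderiv ℝ f y h) z :=
  ((hf.fderiv_right (m := 1) (by norm_num)).differentiableAt one_ne_zero).clm_apply
    (differentiableAt_const h)

/-- **Chain rule bound** `‖∂_h (Φ ∘ u)‖ ≤ ‖DΦ(u z)‖ ‖∂_h u‖`. [folklore] -/
theorem norm_fderiv_comp_apply_le_opNorm {Φ : G → H} {u : ℂ → G} {z : ℂ} (hΦ : DifferentiableAt ℝ Φ (u z))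
    (hu : DifferentiableAt ℝ u z) (h : ℂ) :
    ‖fderiv ℝ (fun y ↦ Φ (u y)) z h‖ ≤ ‖fderiv ℝ Φ (u z)‖ * ‖fderiv ℝ u z h‖ := by
  rw [show (fun y ↦ Φ (u y)) = Φ ∘ u from rfl, fderiv_comp z hΦ hu, ContinuousLinearMap.comp_apply]
  exact (fderiv ℝ Φ (u z)).le_opNorm _

/-- **Second derivative of a composition along `(h, h)`**:
`‖∂_h∂_h (Φ ∘ u)‖ ≤ ‖D²Φ(u z)‖ ‖∂_h u‖² + ‖DΦ(u z)‖ ‖∂_h∂_h u‖`. [folklore] -/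
theorem norm_fderiv_fderiv_comp_apply_le {Φ : G → H} {u : ℂ → G} {z : ℂ}
    (hΦ : ContDiffAt ℝ 2 Φ (u z)) (hu : ContDiffAt ℝ 2 u z) (h : ℂ) :
    ‖fderiv ℝ (fun y ↦ fderiv ℝ (fun y' ↦ Φ (u y')) y h) z h‖ ≤
      ‖fderiv ℝ (fderiv ℝ Φ) (u z)‖ * ‖fderiv ℝ u z h‖ ^ 2 +
        ‖fderiv ℝ Φ (u z)‖ * ‖fderiv ℝ (fun y ↦ fderiv ℝ u y h) z h‖ := by
  have hud : DifferentiableAt ℝ u z := hu.differentiableAt two_ne_zero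
  have hΦd : ∀ᶠ y in 𝓝 z, DifferentiableAt ℝ Φ (u y) := by
    have h1 : ∀ᶠ x in 𝓝 (u z), ContDiffAt ℝ 2 Φ x := hΦ.eventually (by simp)
    exact (hud.continuousAt.eventually h1).mono fun y hy ↦ hy.differentiableAt two_ne_zero
  have hudn : ∀ᶠ y in 𝓝 z, DifferentiableAt ℝ u y :=
    (hu.eventually (by simp)).mono fun y hy ↦ hy.differentiableAt two_ne_zero
  have hev : (fun y ↦ fderiv ℝ (fun y' ↦ Φ (u y')) y h) =ᶠ[𝓝 z]
      fun y ↦ fderiv ℝ Φ (u y) (fderiv ℝ u y h) := by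
    filter_upwards [hΦd, hudn] with y hyΦ hyu
    rw [show (fun y' ↦ Φ (u y')) = Φ ∘ u from rfl, fderiv_comp y hyΦ hyu]
    rfl
  rw [hev.fderiv_eq]
  have hΦ' : DifferentiableAt ℝ (fderiv ℝ Φ) (u z) :=
    (hΦ.fderiv_right (m := 1) (by norm_num)).differentiableAt one_ne_zero
  have hc : DifferentiableAt ℝ (fun y ↦ fderiv ℝ Φ (u y)) z := hΦ'.comp z hud
  have hv : DifferentiableAt ℝ (fun y ↦ fderiv ℝ u y h) z := differentiableAt_fderiv_apply_const hu h
  rw [fderiv_clm_apply hc hv]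
  simp only [_root_.add_apply, ContinuousLinearMap.comp_apply, ContinuousLinearMap.flip_apply]
  have h1 : ‖fderiv ℝ (fun y ↦ fderiv ℝ Φ (u y)) z h‖ ≤
      ‖fderiv ℝ (fderiv ℝ Φ) (u z)‖ * ‖fderiv ℝ u z h‖ := norm_fderiv_comp_apply_le_opNorm hΦ' hud h
  calc _ ≤ ‖fderiv ℝ Φ (u z) (fderiv ℝ (fun y ↦ fderiv ℝ u y h) z h)‖ +
        ‖(fderiv ℝ (fun y ↦ fderiv ℝ Φ (u y)) z h) (fderiv ℝ u z h)‖ := norm_add_le _ _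
    _ ≤ ‖fderiv ℝ Φ (u z)‖ * ‖fderiv ℝ (fun y ↦ fderiv ℝ u y h) z h‖ +
        ‖fderiv ℝ (fderiv ℝ Φ) (u z)‖ * ‖fderiv ℝ u z h‖ * ‖fderiv ℝ u z h‖ :=
        add_le_add ((fderiv ℝ Φ (u z)).le_opNorm _)
          (((fderiv ℝ (fun y ↦ fderiv ℝ Φ (u y)) z h).le_opNorm _).trans
            (mul_le_mul_of_nonneg_right h1 (norm_nonneg _)))
    _ = _ := by ring

/-- **The derivatives of `∂_t u = J(u) ∂_s u`**: at a point where `u` is `C²` and `J`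
differentiable, `∂_h ∂_t u = J(u) ∂_h∂_s u + (DJ(u)[∂_h u]) ∂_s u`. [folklore] -/
theorem fderiv_partial_t_eq {J : G → G →L[ℝ] G} {u : ℂ → G} {z : ℂ} (hu : ContDiffAt ℝ 2 u z)
    (hJ : DifferentiableAt ℝ J (u z))
    (hhol : ∀ᶠ y in 𝓝 z, ∀ ζ : ℂ, fderiv ℝ u y (I * ζ) = J (u y) (fderiv ℝ u y ζ)) (h : ℂ) :
    fderiv ℝ (fun y ↦ fderiv ℝ u y I) z h =
      J (u z) (fderiv ℝ (fun y ↦ fderiv ℝ u y 1) z h) +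
        (fderiv ℝ J (u z) (fderiv ℝ u z h)) (fderiv ℝ u z 1) := by
  have hud : DifferentiableAt ℝ u z := hu.differentiableAt two_ne_zero
  have husd : DifferentiableAt ℝ (fun y ↦ fderiv ℝ u y 1) z :=
    differentiableAt_fderiv_apply_const hu 1
  have hJu : DifferentiableAt ℝ (fun y ↦ J (u y)) z := hJ.comp z hud
  have hJu' : fderiv ℝ (fun y ↦ J (u y)) z = (fderiv ℝ J (u z)).comp (fderiv ℝ u z) :=
    fderiv_comp z hJ hud
  have hut : (fun y ↦ fderiv ℝ u y I) =ᶠ[𝓝 z] fun y ↦ J (u y) (fderiv ℝ u y 1) := by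
    filter_upwards [hhol] with y hy
    simpa using hy 1
  rw [hut.fderiv_eq, fderiv_clm_apply hJu husd, hJu']
  simp only [_root_.add_apply, ContinuousLinearMap.comp_apply, ContinuousLinearMap.flip_apply]

/-- Leibniz rule for `y ↦ B(y)(p(y))(q(y))`, `B(y) : G → G → H` bilinear. [folklore] -/
theorem fderiv_bilinApply {B : ℂ → G →L[ℝ] G →L[ℝ] H} {p q : ℂ → G} {z : ℂ}
    (hB : DifferentiableAt ℝ B z) (hp : DifferentiableAt ℝ p z) (hq : DifferentiableAt ℝ q z)
    (h : ℂ) :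
    fderiv ℝ (fun y ↦ B y (p y) (q y)) z h =
      fderiv ℝ B z h (p z) (q z) + B z (fderiv ℝ p z h) (q z) + B z (p z) (fderiv ℝ q z h) := by
  have hc : DifferentiableAt ℝ (fun y ↦ B y (p y)) z := hB.clm_apply hp
  rw [fderiv_clm_apply hc hq, fderiv_clm_apply hB hp]
  simp only [_root_.add_apply, ContinuousLinearMap.comp_apply, ContinuousLinearMap.flip_apply]
  abel

/-- Norm bound for `fderiv_bilinApply`. [folklore] -/
theorem norm_fderiv_bilinApply_le {B : ℂ → G →L[ℝ] G →L[ℝ] H} {p q : ℂ → G} {z : ℂ}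
    (hB : DifferentiableAt ℝ B z) (hp : DifferentiableAt ℝ p z) (hq : DifferentiableAt ℝ q z)
    (h : ℂ) :
    ‖fderiv ℝ (fun y ↦ B y (p y) (q y)) z h‖ ≤
      ‖fderiv ℝ B z h‖ * ‖p z‖ * ‖q z‖ + ‖B z‖ * ‖fderiv ℝ p z h‖ * ‖q z‖ +
        ‖B z‖ * ‖p z‖ * ‖fderiv ℝ q z h‖ := by
  rw [fderiv_bilinApply hB hp hq]
  exact (norm_add₃_le).trans (add_le_add_three ((fderiv ℝ B z h).le_opNorm₂ _ _)
    ((B z).le_opNorm₂ _ _) ((B z).le_opNorm₂ _ _))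

/-- **Second derivative of `B(y)(p(y))(q(y))` along `(h, h)`** (nine-term Leibniz expansion), for
`B, p, q` of class `C²` at the point. [folklore] -/
theorem fderiv_fderiv_bilinApply {B : ℂ → G →L[ℝ] G →L[ℝ] H} {p q : ℂ → G} {z : ℂ}
    (hB : ContDiffAt ℝ 2 B z) (hp : ContDiffAt ℝ 2 p z) (hq : ContDiffAt ℝ 2 q z) (h : ℂ) :
    fderiv ℝ (fun y ↦ fderiv ℝ (fun y' ↦ B y' (p y') (q y')) y h) z h =
      fderiv ℝ (fun y ↦ fderiv ℝ B y h) z h (p z) (q z) +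
        2 • fderiv ℝ B z h (fderiv ℝ p z h) (q z) + 2 • fderiv ℝ B z h (p z) (fderiv ℝ q z h) +
        B z (fderiv ℝ (fun y ↦ fderiv ℝ p y h) z h) (q z) +
        2 • B z (fderiv ℝ p z h) (fderiv ℝ q z h) +
        B z (p z) (fderiv ℝ (fun y ↦ fderiv ℝ q y h) z h) := by
  have hBd : ∀ᶠ y in 𝓝 z, DifferentiableAt ℝ B y :=
    (hB.eventually (by simp)).mono fun y hy ↦ hy.differentiableAt two_ne_zero
  have hpd : ∀ᶠ y in 𝓝 z, DifferentiableAt ℝ p y :=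
    (hp.eventually (by simp)).mono fun y hy ↦ hy.differentiableAt two_ne_zero
  have hqd : ∀ᶠ y in 𝓝 z, DifferentiableAt ℝ q y :=
    (hq.eventually (by simp)).mono fun y hy ↦ hy.differentiableAt two_ne_zero
  have h1 : (fun y ↦ fderiv ℝ (fun y' ↦ B y' (p y') (q y')) y h) =ᶠ[𝓝 z] fun y ↦
      fderiv ℝ B y h (p y) (q y) + B y (fderiv ℝ p y h) (q y) + B y (p y) (fderiv ℝ q y h) := by
    filter_upwards [hBd, hpd, hqd] with y hyB hyp hyq
    exact fderiv_bilinApply hyB hyp hyq h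
  rw [h1.fderiv_eq]
  have hBz := hB.differentiableAt two_ne_zero
  have hpz := hp.differentiableAt two_ne_zero
  have hqz := hq.differentiableAt two_ne_zero
  have hB1 : DifferentiableAt ℝ (fun y ↦ fderiv ℝ B y h) z := differentiableAt_fderiv_apply_const hB h
  have hp1 : DifferentiableAt ℝ (fun y ↦ fderiv ℝ p y h) z := differentiableAt_fderiv_apply_const hp h
  have hq1 : DifferentiableAt ℝ (fun y ↦ fderiv ℝ q y h) z := differentiableAt_fderiv_apply_const hq h
  have hT1 : DifferentiableAt ℝ (fun y ↦ fderiv ℝ B y h (p y) (q y)) z := (hB1.clm_apply hpz).clm_apply hqz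
  have hT2 : DifferentiableAt ℝ (fun y ↦ B y (fderiv ℝ p y h) (q y)) z := (hBz.clm_apply hp1).clm_apply hqz
  have hT3 : DifferentiableAt ℝ (fun y ↦ B y (p y) (fderiv ℝ q y h)) z := (hBz.clm_apply hpz).clm_apply hq1
  have hT12 : DifferentiableAt ℝ
      (fun y ↦ fderiv ℝ B y h (p y) (q y) + B y (fderiv ℝ p y h) (q y)) z := hT1.add hT2
  rw [fderiv_fun_add hT12 hT3, fderiv_fun_add hT1 hT2]
  simp only [_root_.add_apply]
  rw [fderiv_bilinApply hB1 hpz hqz, fderiv_bilinApply hBz hp1 hqz, fderiv_bilinApply hBz hpz hq1]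
  simp only [two_smul]
  abel


end Generic

/-! ### The tamed energy density -/

section Tamed

variable {F : Type*} [NormedAddCommGroup F] [InnerProductSpace ℝ F]

/-- AM–GM bookkeeping: `c x² P ≤ 2κ P² + c² x⁴ / (8κ)`. [folklore] -/
theorem amgm_tamed_aux {c x P κ : ℝ} (hκ : 0 < κ) :
    c * x ^ 2 * P ≤ 2 * κ * P ^ 2 + c ^ 2 * x ^ 4 / (8 * κ) := by
  have h := sq_nonneg (4 * κ * P - c * x ^ 2)
  have h8 : 0 < 8 * κ := by positivity
  rw [← sub_nonneg]
  have : 2 * κ * P ^ 2 + c ^ 2 * x ^ 4 / (8 * κ) - c * x ^ 2 * P =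
      (4 * κ * P - c * x ^ 2) ^ 2 / (8 * κ) := by
    field_simp
    ring
  rw [this]
  positivity

/-- The real-arithmetic core of `laplacian_tamedDensity_ge` (garbage collection with `b ≤ Ma`,
`R₂ ≤ M P₂ + M b a`, absorption of the mixed terms by AM–GM, and `κ²a⁴ ≤ T²`). [folklore] -/
theorem tamed_arith {a b P₁ P₂ R₁ R₂ M κ T t1 t1' s2 s2' s3 s3' t4 s5 s5' t6 : ℝ}
    (hM : 1 ≤ M) (hκ : 0 < κ) (ha : 0 ≤ a) (hb : 0 ≤ b) (hP₁ : 0 ≤ P₁) (hP₂ : 0 ≤ P₂)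
    (hR₂ : 0 ≤ R₂) (hbM : b ≤ M * a) (hR1 : R₁ = P₂) (hR2 : R₂ ≤ M * P₂ + M * b * a)
    (hT : κ ^ 2 * a ^ 4 ≤ T ^ 2)
    (h1 : -((M * a ^ 2 + M * P₁) * a * b) ≤ t1) (h1' : -((M * b ^ 2 + M * R₂) * a * b) ≤ t1')
    (h2 : -(M * a * P₁ * b) ≤ s2) (h2' : -(M * b * P₂ * b) ≤ s2')
    (h3 : -(M * a * a * R₁) ≤ s3) (h3' : -(M * b * a * R₂) ≤ s3')
    (h4 : -(M * (2 * (M * a * a * b + M * R₁ * a + M * b * P₁)) * b) ≤ t4)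
    (h5 : 2 * (κ * P₁ ^ 2 - M * P₁ * (M * a * a)) ≤ 2 * s5)
    (h5' : 2 * (κ * P₂ ^ 2 - M * P₂ * (M * b * a)) ≤ 2 * s5')
    (h6 : -(M * a * (2 * (M * b * a * b + M * R₂ * a + M * b * P₂))) ≤ t6) :
    -((11 + 35 / κ) * M ^ 8 / κ ^ 2 * T ^ 2) ≤
      t1 + 2 * s2 + 2 * s3 + t4 + 2 * s5 + t6 + (t1' + 2 * s2' + 2 * s3' + 2 * s5') := by
  have hM0 : 0 ≤ M := zero_le_one.trans hM
  rw [hR1] at h3 h4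
  have hb2 : b ^ 2 ≤ M ^ 2 * a ^ 2 := by
    have := mul_le_mul hbM hbM hb (by positivity)
    linarith only [this]
  have hab : a * b ≤ M * a ^ 2 := by
    have := mul_le_mul_of_nonneg_left hbM ha
    linarith only [this]
  have hMba : M * b * a ≤ M * (M * a) * a :=
    mul_le_mul_of_nonneg_right (mul_le_mul_of_nonneg_left hbM hM0) ha
  have hR2' : R₂ ≤ M * P₂ + M ^ 2 * a ^ 2 := by linarith only [hR2, hMba]
  have g1 : (M * a ^ 2 + M * P₁) * a * b ≤ M ^ 2 * a ^ 4 + M ^ 2 * a ^ 2 * P₁ := by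
    have := mul_le_mul_of_nonneg_left hab (by positivity : 0 ≤ M * a ^ 2 + M * P₁)
    linarith only [this]
  have g2 : (M * b ^ 2 + M * R₂) * a * b ≤ 2 * M ^ 4 * a ^ 4 + M ^ 3 * a ^ 2 * P₂ := by
    have h1 : M * b ^ 2 + M * R₂ ≤ M * (M ^ 2 * a ^ 2) + M * (M * P₂ + M ^ 2 * a ^ 2) :=
      add_le_add (mul_le_mul_of_nonneg_left hb2 hM0) (mul_le_mul_of_nonneg_left hR2' hM0)
    have h2 := mul_le_mul h1 hab (mul_nonneg ha hb) (by positivity)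
    linarith only [h2]
  have g3 : M * a * P₁ * b ≤ M ^ 2 * a ^ 2 * P₁ := by
    have := mul_le_mul_of_nonneg_left hbM (by positivity : 0 ≤ M * a * P₁)
    linarith only [this]
  have g4 : M * b * P₂ * b ≤ M ^ 3 * a ^ 2 * P₂ := by
    have := mul_le_mul_of_nonneg_left hb2 (by positivity : 0 ≤ M * P₂)
    linarith only [this]
  have g6 : M * b * a * R₂ ≤ M ^ 3 * a ^ 2 * P₂ + M ^ 4 * a ^ 4 := by
    have h1 := mul_le_mul hab hR2' hR₂ (by positivity)
    have h2 := mul_le_mul_of_nonneg_left h1 hM0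
    linarith only [h2]
  have g7 : M * (2 * (M * a * a * b + M * P₂ * a + M * b * P₁)) * b ≤
      2 * M ^ 4 * a ^ 4 + 2 * M ^ 3 * a ^ 2 * P₂ + 2 * M ^ 4 * a ^ 2 * P₁ := by
    have e1 := mul_le_mul_of_nonneg_left hbM (by positivity : 0 ≤ M * a * a)
    have e2 := mul_le_mul_of_nonneg_right (mul_le_mul_of_nonneg_left hbM hM0) hP₁
    have h1 : M * a * a * b + M * P₂ * a + M * b * P₁ ≤
        M * a * a * (M * a) + M * P₂ * a + M * (M * a) * P₁ := by linarith only [e1, e2]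
    have h2 := mul_le_mul h1 hbM hb (by positivity)
    have h3 := mul_le_mul_of_nonneg_left h2 (by positivity : (0 : ℝ) ≤ 2 * M)
    linarith only [h3]
  have g8 : M * P₂ * (M * b * a) ≤ M ^ 3 * a ^ 2 * P₂ := by
    have := mul_le_mul_of_nonneg_left hab (by positivity : 0 ≤ M * P₂ * M)
    linarith only [this]
  have g9 : M * a * (2 * (M * b * a * b + M * R₂ * a + M * b * P₂)) ≤
      4 * M ^ 4 * a ^ 4 + 4 * M ^ 3 * a ^ 2 * P₂ := by
    have e1 := mul_le_mul_of_nonneg_left hb2 (by positivity : 0 ≤ M * a)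
    have e2 := mul_le_mul_of_nonneg_right (mul_le_mul_of_nonneg_left hR2' hM0) ha
    have e3 := mul_le_mul_of_nonneg_right (mul_le_mul_of_nonneg_left hbM hM0) hP₂
    have h1 : M * b * a * b + M * R₂ * a + M * b * P₂ ≤
        M * a * (M ^ 2 * a ^ 2) + M * (M * P₂ + M ^ 2 * a ^ 2) * a + M * (M * a) * P₂ := by
      linarith only [e1, e2, e3]
    have h2 := mul_le_mul_of_nonneg_left h1 (by positivity : 0 ≤ M * a * 2)
    linarith only [h2]
  -- powers of `M ≥ 1`
  have hM2 : M ^ 2 ≤ M ^ 4 := pow_le_pow_right₀ hM (by norm_num)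
  have hM3 : M ^ 3 ≤ M ^ 4 := pow_le_pow_right₀ hM (by norm_num)
  have hM1 : M ≤ M ^ 4 := le_self_pow₀ hM (by norm_num)
  have hM48 : M ^ 4 ≤ M ^ 8 := pow_le_pow_right₀ hM (by norm_num)
  have k1 : M ^ 2 * a ^ 4 ≤ M ^ 4 * a ^ 4 := mul_le_mul_of_nonneg_right hM2 (by positivity)
  have k2 : M ^ 2 * a ^ 2 * P₁ ≤ M ^ 4 * a ^ 2 * P₁ :=
    mul_le_mul_of_nonneg_right (mul_le_mul_of_nonneg_right hM2 (by positivity)) hP₁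
  have k3 : M ^ 3 * a ^ 2 * P₂ ≤ M ^ 4 * a ^ 2 * P₂ :=
    mul_le_mul_of_nonneg_right (mul_le_mul_of_nonneg_right hM3 (by positivity)) hP₂
  have k4 : M * a ^ 2 * P₂ ≤ M ^ 4 * a ^ 2 * P₂ :=
    mul_le_mul_of_nonneg_right (mul_le_mul_of_nonneg_right hM1 (by positivity)) hP₂
  have k5 : M ^ 4 * a ^ 4 ≤ M ^ 8 * a ^ 4 := mul_le_mul_of_nonneg_right hM48 (by positivity)
  -- AM–GM absorptions
  have am1 : 7 * M ^ 4 * a ^ 2 * P₁ ≤ 2 * κ * P₁ ^ 2 + (7 * M ^ 4) ^ 2 * a ^ 4 / (8 * κ) :=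
    amgm_tamed_aux hκ
  have am2 : 15 * M ^ 4 * a ^ 2 * P₂ ≤ 2 * κ * P₂ ^ 2 + (15 * M ^ 4) ^ 2 * a ^ 4 / (8 * κ) :=
    amgm_tamed_aux hκ
  have h274 : (7 * M ^ 4) ^ 2 * a ^ 4 / (8 * κ) + (15 * M ^ 4) ^ 2 * a ^ 4 / (8 * κ) ≤
      35 / κ * M ^ 8 * a ^ 4 := by
    have hX : 0 ≤ M ^ 8 * a ^ 4 / κ := by positivity
    have h1 : (7 * M ^ 4) ^ 2 * a ^ 4 / (8 * κ) + (15 * M ^ 4) ^ 2 * a ^ 4 / (8 * κ) =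
        (274 / 8) * (M ^ 8 * a ^ 4 / κ) := by
      field_simp
      ring
    have h2 : 35 / κ * M ^ 8 * a ^ 4 = 35 * (M ^ 8 * a ^ 4 / κ) := by ring
    rw [h1, h2]
    linarith only [hX]
  have hfin : (11 + 35 / κ) * M ^ 8 * a ^ 4 ≤ (11 + 35 / κ) * M ^ 8 / κ ^ 2 * T ^ 2 := by
    have h := mul_le_mul_of_nonneg_left hT (show 0 ≤ (11 + 35 / κ) * M ^ 8 / κ ^ 2 by positivity)
    calc (11 + 35 / κ) * M ^ 8 * a ^ 4 = (11 + 35 / κ) * M ^ 8 / κ ^ 2 * (κ ^ 2 * a ^ 4) := by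
          field_simp
      _ ≤ _ := h
  have hexp : (11 + 35 / κ) * M ^ 8 * a ^ 4 = 11 * M ^ 8 * a ^ 4 + 35 / κ * M ^ 8 * a ^ 4 := by
    ring
  linarith only [h1, h1', h2, h2', h3, h3', h4, h5, h5', h6, g1, g2, g3, g4, g6, g7, g8, g9, k1,
    k2, k3, k4, k5, am1, am2, h274, hfin, hexp]

/-- **`Δẽ ≥ -A ẽ²` for the tamed energy density `ẽ = ω(∂_s u, ∂_t u)` of a `J`-holomorphic map**
(flat coordinates). Let `u : ℂ → F` be `C³` on an open `V ∋ z`, `J`-holomorphic on `V`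
(`∂_t u = J(u)∂_s u`, `J(u)² = -1`); let `Ω : F → L²(F; ℝ)` (the symplectic form in the chart)
and `J` be `C²` at `x = u z`, with all of `‖Ω(x)‖, ‖DΩ(x)‖, ‖D²Ω(x)‖, ‖J(x)‖, ‖DJ(x)‖, ‖D²J(x)‖`
bounded by `M ≥ 1`, and `Ω(x)(v, J(x)v) ≥ κ‖v‖²` (`κ > 0`, taming). Then the density
`ẽ(y) = Ω(u y)(∂_s u(y), ∂_t u(y))` — which is `(u^*ω)_y(∂_s, ∂_t)`, a function on the DOMAIN,
independent of the chart — satisfies at `z`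

  `Δẽ(z) ≥ -((11 + 35/κ) M⁸ / κ²) ẽ(z)²`.

(McDuff–Salamon (2012), proof of Lemma 4.3.1, in the form needed on a manifold: the good term
`2 Σ_h Ω(∂_h∂_s u, ∂_h∂_t u) = 2 Σ_h Ω(∂_h∂_s u, J ∂_h∂_s u) + O(|du|²|∇du|) ≥ 2κ|∇∂_s u|² - …`
controls, after the quadratic formula `Δu = DJ(u)[∂_t u]∂_s u - DJ(u)[∂_s u]∂_t u` and the
symmetry of third derivatives, every other term of the Leibniz expansion of
`Δ[Ω(u)(∂_s u, ∂_t u)]`.) [cite: McDuffSalamon2012, Lemma 4.3.1] -/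
theorem laplacian_tamedDensity_ge {Ω : F → F →L[ℝ] F →L[ℝ] ℝ} {J : F → F →L[ℝ] F} {u : ℂ → F}
    {V : Set ℂ} (hV : IsOpen V) {z : ℂ} (hz : z ∈ V) (hu : ContDiffOn ℝ 3 u V)
    (hΩ : ContDiffAt ℝ 2 Ω (u z)) (hJ : ContDiffAt ℝ 2 J (u z))
    (hJ2 : ∀ y ∈ V, ∀ v, J (u y) (J (u y) v) = -v)
    (hhol : ∀ y ∈ V, ∀ ζ : ℂ, fderiv ℝ u y (I * ζ) = J (u y) (fderiv ℝ u y ζ))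
    {M κ : ℝ} (hM : 1 ≤ M) (hκ : 0 < κ)
    (hΩ0 : ‖Ω (u z)‖ ≤ M) (hΩ1 : ‖fderiv ℝ Ω (u z)‖ ≤ M) (hΩ2 : ‖fderiv ℝ (fderiv ℝ Ω) (u z)‖ ≤ M)
    (hJ0 : ‖J (u z)‖ ≤ M) (hJ1 : ‖fderiv ℝ J (u z)‖ ≤ M) (hJ2' : ‖fderiv ℝ (fderiv ℝ J) (u z)‖ ≤ M)
    (htame : ∀ v, κ * ‖v‖ ^ 2 ≤ Ω (u z) v (J (u z) v)) :
    -((11 + 35 / κ) * M ^ 8 / κ ^ 2 *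
        (Ω (u z) (fderiv ℝ u z 1) (fderiv ℝ u z I)) ^ 2) ≤
      fderiv ℝ (fderiv ℝ fun y ↦ Ω (u y) (fderiv ℝ u y 1) (fderiv ℝ u y I)) z 1 1 +
        fderiv ℝ (fderiv ℝ fun y ↦ Ω (u y) (fderiv ℝ u y 1) (fderiv ℝ u y I)) z I I := by
  -- regularity
  have hVz : V ∈ 𝓝 z := hV.mem_nhds hz
  have hu2 : ∀ y ∈ V, ContDiffAt ℝ 2 u y := fun y hy ↦
    (hu.of_le (by norm_num)).contDiffAt (hV.mem_nhds hy)
  have hu2z : ContDiffAt ℝ 2 u z := hu2 z hz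
  have hud : DifferentiableAt ℝ u z := hu2z.differentiableAt two_ne_zero
  have husz : ContDiffAt ℝ 2 (fun y ↦ fderiv ℝ u y 1) z :=
    (contDiffOn_fderiv_apply_const_of_contDiffOn hV hu 1).contDiffAt hVz
  have hutz : ContDiffAt ℝ 2 (fun y ↦ fderiv ℝ u y I) z :=
    (contDiffOn_fderiv_apply_const_of_contDiffOn hV hu I).contDiffAt hVz
  have husd : DifferentiableAt ℝ (fun y ↦ fderiv ℝ u y 1) z := husz.differentiableAt two_ne_zero
  have hutd : DifferentiableAt ℝ (fun y ↦ fderiv ℝ u y I) z := hutz.differentiableAt two_ne_zero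
  have hBz : ContDiffAt ℝ 2 (fun y ↦ Ω (u y)) z := hΩ.comp z hu2z
  have hBd : DifferentiableAt ℝ (fun y ↦ Ω (u y)) z := hBz.differentiableAt two_ne_zero
  have hJd : DifferentiableAt ℝ J (u z) := hJ.differentiableAt two_ne_zero
  have hJ' : DifferentiableAt ℝ (fderiv ℝ J) (u z) :=
    (hJ.fderiv_right (m := 1) (by norm_num)).differentiableAt one_ne_zero
  have hJdn : ∀ᶠ y in 𝓝 z, DifferentiableAt ℝ J (u y) := by
    have h1 : ∀ᶠ x in 𝓝 (u z), ContDiffAt ℝ 2 J x := hJ.eventually (by simp)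
    exact (hud.continuousAt.eventually h1).mono fun y hy ↦ hy.differentiableAt two_ne_zero
  have hDJu : DifferentiableAt ℝ (fun y ↦ fderiv ℝ J (u y)) z := hJ'.comp z hud
  have hholz : ∀ᶠ y in 𝓝 z, ∀ ζ : ℂ, fderiv ℝ u y (I * ζ) = J (u y) (fderiv ℝ u y ζ) :=
    eventually_of_mem hVz fun y hy ↦ hhol y hy
  -- the second derivative through partial derivatives
  have hT2 : ContDiffAt ℝ 2 (fun y ↦ Ω (u y) (fderiv ℝ u y 1) (fderiv ℝ u y I)) z :=
    (hBz.clm_apply husz).clm_apply hutz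
  have happ : ∀ h, fderiv ℝ (fderiv ℝ fun y ↦ Ω (u y) (fderiv ℝ u y 1) (fderiv ℝ u y I)) z h h =
      fderiv ℝ (fun y ↦ fderiv ℝ (fun y' ↦ Ω (u y') (fderiv ℝ u y' 1) (fderiv ℝ u y' I)) y h)
        z h := by
    intro h
    have hd : DifferentiableAt ℝ
        (fderiv ℝ fun y ↦ Ω (u y) (fderiv ℝ u y 1) (fderiv ℝ u y I)) z :=
      (hT2.fderiv_right (m := 1) (by norm_num)).differentiableAt one_ne_zero
    rw [fderiv_clm_apply hd (differentiableAt_const h)]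
    simp
  rw [happ 1, happ I, fderiv_fderiv_bilinApply hBz husz hutz 1,
    fderiv_fderiv_bilinApply hBz husz hutz I]
  -- `Δ∂_s u = ∂_s Q`, `Δ∂_t u = ∂_t Q`
  have husd2 : ∀ h, DifferentiableAt ℝ (fun y ↦ fderiv ℝ (fun y' ↦ fderiv ℝ u y' 1) y h) z :=
    fun h ↦ differentiableAt_fderiv_apply_const husz h
  have hutd2 : ∀ h, DifferentiableAt ℝ (fun y ↦ fderiv ℝ (fun y' ↦ fderiv ℝ u y' I) y h) z :=
    fun h ↦ differentiableAt_fderiv_apply_const hutz h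
  have hLQ : (fun y ↦ fderiv ℝ (fun y' ↦ fderiv ℝ u y' 1) y 1 +
      fderiv ℝ (fun y' ↦ fderiv ℝ u y' I) y I) =ᶠ[𝓝 z]
      fun y ↦ fderiv ℝ J (u y) (fderiv ℝ u y I) (fderiv ℝ u y 1) -
        fderiv ℝ J (u y) (fderiv ℝ u y 1) (fderiv ℝ u y I) := by
    filter_upwards [hVz, hJdn] with y hy hyJ
    exact laplacian_eq_of_jHolomorphic_nhds (hu2 y hy) hyJ
      (eventually_of_mem (hV.mem_nhds hy) fun y' hy' ↦ hJ2 y' hy')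
      (eventually_of_mem (hV.mem_nhds hy) fun y' hy' ↦ hhol y' hy')
  have hmix : (fun y ↦ fderiv ℝ (fun y' ↦ fderiv ℝ u y' I) y 1) =ᶠ[𝓝 z]
      fun y ↦ fderiv ℝ (fun y' ↦ fderiv ℝ u y' 1) y I := by
    filter_upwards [hVz] with y hy
    exact (fderiv_partial_comm_of_contDiffAt (hu2 y hy) 1 I).symm
  have hΔus : fderiv ℝ (fun y ↦ fderiv ℝ (fun y' ↦ fderiv ℝ u y' 1) y 1) z 1 +
      fderiv ℝ (fun y ↦ fderiv ℝ (fun y' ↦ fderiv ℝ u y' 1) y I) z I =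
      fderiv ℝ (fun y ↦ fderiv ℝ J (u y) (fderiv ℝ u y I) (fderiv ℝ u y 1) -
        fderiv ℝ J (u y) (fderiv ℝ u y 1) (fderiv ℝ u y I)) z 1 := by
    rw [← hLQ.fderiv_eq]
    have h1 : fderiv ℝ (fun y ↦ fderiv ℝ (fun y' ↦ fderiv ℝ u y' 1) y I) z I =
        fderiv ℝ (fun y ↦ fderiv ℝ (fun y' ↦ fderiv ℝ u y' I) y I) z 1 := by
      rw [← hmix.fderiv_eq]
      exact fderiv_partial_comm_of_contDiffAt hutz 1 I
    rw [h1, fderiv_fun_add (husd2 1) (hutd2 I)]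
    rfl
  have hΔut : fderiv ℝ (fun y ↦ fderiv ℝ (fun y' ↦ fderiv ℝ u y' I) y 1) z 1 +
      fderiv ℝ (fun y ↦ fderiv ℝ (fun y' ↦ fderiv ℝ u y' I) y I) z I =
      fderiv ℝ (fun y ↦ fderiv ℝ J (u y) (fderiv ℝ u y I) (fderiv ℝ u y 1) -
        fderiv ℝ J (u y) (fderiv ℝ u y 1) (fderiv ℝ u y I)) z I := by
    rw [← hLQ.fderiv_eq]
    have h1 : fderiv ℝ (fun y ↦ fderiv ℝ (fun y' ↦ fderiv ℝ u y' I) y 1) z 1 =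
        fderiv ℝ (fun y ↦ fderiv ℝ (fun y' ↦ fderiv ℝ u y' 1) y 1) z I := by
      rw [hmix.fderiv_eq]
      exact (fderiv_partial_comm_of_contDiffAt husz 1 I).symm
    rw [h1, fderiv_fun_add (husd2 1) (hutd2 I)]
    rfl
  -- bounds on `∂_h Q`
  have hQ : ∀ h, ‖fderiv ℝ (fun y ↦ fderiv ℝ J (u y) (fderiv ℝ u y I) (fderiv ℝ u y 1) -
      fderiv ℝ J (u y) (fderiv ℝ u y 1) (fderiv ℝ u y I)) z h‖ ≤
      2 * (M * ‖fderiv ℝ u z h‖ * ‖fderiv ℝ u z 1‖ * ‖fderiv ℝ u z I‖ +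
        M * ‖fderiv ℝ (fun y ↦ fderiv ℝ u y I) z h‖ * ‖fderiv ℝ u z 1‖ +
        M * ‖fderiv ℝ u z I‖ * ‖fderiv ℝ (fun y ↦ fderiv ℝ u y 1) z h‖) := by
    intro h
    have hf : DifferentiableAt ℝ
        (fun y ↦ fderiv ℝ J (u y) (fderiv ℝ u y I) (fderiv ℝ u y 1)) z :=
      (hDJu.clm_apply hutd).clm_apply husd
    have hg : DifferentiableAt ℝ
        (fun y ↦ fderiv ℝ J (u y) (fderiv ℝ u y 1) (fderiv ℝ u y I)) z :=
      (hDJu.clm_apply husd).clm_apply hutd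
    rw [fderiv_fun_sub hf hg]
    have h1 := norm_fderiv_bilinApply_le hDJu hutd husd h
    have h2 := norm_fderiv_bilinApply_le hDJu husd hutd h
    have hB1 : ‖fderiv ℝ (fun y ↦ fderiv ℝ J (u y)) z h‖ ≤ M * ‖fderiv ℝ u z h‖ :=
      (norm_fderiv_comp_apply_le_opNorm hJ' hud h).trans (mul_le_mul_of_nonneg_right hJ2' (norm_nonneg _))
    have ha := norm_nonneg (fderiv ℝ u z 1)
    have hb := norm_nonneg (fderiv ℝ u z I)
    have hp1 := norm_nonneg (fderiv ℝ (fun y ↦ fderiv ℝ u y 1) z h)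
    have hp2 := norm_nonneg (fderiv ℝ (fun y ↦ fderiv ℝ u y I) z h)
    have hBn := norm_nonneg (fderiv ℝ (fun y ↦ fderiv ℝ J (u y)) z h)
    have hBz' := norm_nonneg (fderiv ℝ J (u z))
    calc _ ≤ _ := norm_sub_le _ _
      _ ≤ _ := add_le_add h1 h2
      _ ≤ _ := by
        nlinarith [mul_le_mul_of_nonneg_right hB1 (mul_nonneg hb ha),
          mul_le_mul_of_nonneg_right hB1 (mul_nonneg ha hb),
          mul_le_mul_of_nonneg_right hJ1 (mul_nonneg hp2 ha),
          mul_le_mul_of_nonneg_right hJ1 (mul_nonneg hb hp1),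
          mul_le_mul_of_nonneg_right hJ1 (mul_nonneg hp1 hb),
          mul_le_mul_of_nonneg_right hJ1 (mul_nonneg ha hp2)]
  -- normalise the expansion
  simp only [nsmul_eq_mul, Nat.cast_ofNat]
  -- vector identities at `z`
  have hqz : fderiv ℝ u z I = J (u z) (fderiv ℝ u z 1) := by simpa using hhol z hz 1
  have hdq : ∀ h, fderiv ℝ (fun y ↦ fderiv ℝ u y I) z h =
      J (u z) (fderiv ℝ (fun y ↦ fderiv ℝ u y 1) z h) +
        (fderiv ℝ J (u z) (fderiv ℝ u z h)) (fderiv ℝ u z 1) :=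
    fun h ↦ fderiv_partial_t_eq hu2z hJd hholz h
  have hR1v : fderiv ℝ (fun y ↦ fderiv ℝ u y I) z 1 = fderiv ℝ (fun y ↦ fderiv ℝ u y 1) z I :=
    (fderiv_partial_comm_of_contDiffAt hu2z 1 I).symm
  have hM0 : 0 ≤ M := zero_le_one.trans hM
  have ha0 := norm_nonneg (fderiv ℝ u z 1)
  have hb0 := norm_nonneg (fderiv ℝ u z I)
  have hbM : ‖fderiv ℝ u z I‖ ≤ M * ‖fderiv ℝ u z 1‖ := by
    rw [hqz]
    exact ((J (u z)).le_opNorm _).trans (mul_le_mul_of_nonneg_right hJ0 ha0)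
  have hR2 : ‖fderiv ℝ (fun y ↦ fderiv ℝ u y I) z I‖ ≤
      M * ‖fderiv ℝ (fun y ↦ fderiv ℝ u y 1) z I‖ + M * ‖fderiv ℝ u z I‖ * ‖fderiv ℝ u z 1‖ := by
    rw [hdq I]
    refine (norm_add_le _ _).trans (add_le_add ?_ ?_)
    · exact ((J (u z)).le_opNorm _).trans (mul_le_mul_of_nonneg_right hJ0 (norm_nonneg _))
    · exact ((fderiv ℝ J (u z) (fderiv ℝ u z I)).le_opNorm _).trans
        (mul_le_mul_of_nonneg_right (((fderiv ℝ J (u z)).le_opNorm _).trans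
          (mul_le_mul_of_nonneg_right hJ1 hb0)) ha0)
  -- t1: second derivatives of `Ω ∘ u`
  have hB2 : ∀ h, ‖fderiv ℝ (fun y ↦ fderiv ℝ (fun y' ↦ Ω (u y')) y h) z h‖ ≤
      M * ‖fderiv ℝ u z h‖ ^ 2 + M * ‖fderiv ℝ (fun y ↦ fderiv ℝ u y h) z h‖ := fun h ↦
    (norm_fderiv_fderiv_comp_apply_le hΩ hu2z h).trans (add_le_add
      (mul_le_mul_of_nonneg_right hΩ2 (sq_nonneg _))
      (mul_le_mul_of_nonneg_right hΩ1 (norm_nonneg _)))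
  have ht1 : ∀ h, -((M * ‖fderiv ℝ u z h‖ ^ 2 + M * ‖fderiv ℝ (fun y ↦ fderiv ℝ u y h) z h‖) *
      ‖fderiv ℝ u z 1‖ * ‖fderiv ℝ u z I‖) ≤
      fderiv ℝ (fun y ↦ fderiv ℝ (fun y' ↦ Ω (u y')) y h) z h (fderiv ℝ u z 1)
        (fderiv ℝ u z I) := by
    intro h
    refine neg_le.1 ((neg_le_abs _).trans ?_)
    rw [← Real.norm_eq_abs]
    refine ((fderiv ℝ (fun y ↦ fderiv ℝ (fun y' ↦ Ω (u y')) y h) z h).le_opNorm₂ _ _).trans ?_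
    exact mul_le_mul_of_nonneg_right (mul_le_mul_of_nonneg_right (hB2 h) ha0) hb0
  -- t2, t3: first derivatives of `Ω ∘ u`
  have hB1 : ∀ h, ‖fderiv ℝ (fun y ↦ Ω (u y)) z h‖ ≤ M * ‖fderiv ℝ u z h‖ := fun h ↦
    (norm_fderiv_comp_apply_le_opNorm (hΩ.differentiableAt two_ne_zero) hud h).trans
      (mul_le_mul_of_nonneg_right hΩ1 (norm_nonneg _))
  have ht23 : ∀ h (v w : F), -(M * ‖fderiv ℝ u z h‖ * ‖v‖ * ‖w‖) ≤
      fderiv ℝ (fun y ↦ Ω (u y)) z h v w := by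
    intro h v w
    refine neg_le.1 ((neg_le_abs _).trans ?_)
    rw [← Real.norm_eq_abs]
    refine ((fderiv ℝ (fun y ↦ Ω (u y)) z h).le_opNorm₂ _ _).trans ?_
    exact mul_le_mul_of_nonneg_right (mul_le_mul_of_nonneg_right (hB1 h) (norm_nonneg _))
      (norm_nonneg _)
  -- t4, t6: the third-order terms, combined over `h`
  have hΩz : ∀ v w : F, ‖Ω (u z) v w‖ ≤ M * ‖v‖ * ‖w‖ := fun v w ↦
    ((Ω (u z)).le_opNorm₂ v w).trans (by gcongr)
  have ht4 : -(M * (2 * (M * ‖fderiv ℝ u z 1‖ * ‖fderiv ℝ u z 1‖ * ‖fderiv ℝ u z I‖ +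
        M * ‖fderiv ℝ (fun y ↦ fderiv ℝ u y I) z 1‖ * ‖fderiv ℝ u z 1‖ +
        M * ‖fderiv ℝ u z I‖ * ‖fderiv ℝ (fun y ↦ fderiv ℝ u y 1) z 1‖)) * ‖fderiv ℝ u z I‖) ≤
      Ω (u z) (fderiv ℝ (fun y ↦ fderiv ℝ (fun y' ↦ fderiv ℝ u y' 1) y 1) z 1) (fderiv ℝ u z I) +
        Ω (u z) (fderiv ℝ (fun y ↦ fderiv ℝ (fun y' ↦ fderiv ℝ u y' 1) y I) z I)
          (fderiv ℝ u z I) := by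
    rw [← _root_.add_apply, ← map_add, hΔus]
    refine neg_le.1 ((neg_le_abs _).trans ?_)
    rw [← Real.norm_eq_abs]
    exact (hΩz _ _).trans
      (mul_le_mul_of_nonneg_right (mul_le_mul_of_nonneg_left (hQ 1) hM0) hb0)
  have ht6 : -(M * ‖fderiv ℝ u z 1‖ * (2 * (M * ‖fderiv ℝ u z I‖ * ‖fderiv ℝ u z 1‖ *
        ‖fderiv ℝ u z I‖ + M * ‖fderiv ℝ (fun y ↦ fderiv ℝ u y I) z I‖ * ‖fderiv ℝ u z 1‖ +
        M * ‖fderiv ℝ u z I‖ * ‖fderiv ℝ (fun y ↦ fderiv ℝ u y 1) z I‖))) ≤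
      Ω (u z) (fderiv ℝ u z 1) (fderiv ℝ (fun y ↦ fderiv ℝ (fun y' ↦ fderiv ℝ u y' I) y 1) z 1) +
        Ω (u z) (fderiv ℝ u z 1)
          (fderiv ℝ (fun y ↦ fderiv ℝ (fun y' ↦ fderiv ℝ u y' I) y I) z I) := by
    rw [← map_add, hΔut]
    refine neg_le.1 ((neg_le_abs _).trans ?_)
    rw [← Real.norm_eq_abs]
    exact (hΩz _ _).trans (mul_le_mul_of_nonneg_left (hQ I) (mul_nonneg hM0 ha0))
  -- t5: the good term
  have ht5 : ∀ h, 2 * (κ * ‖fderiv ℝ (fun y ↦ fderiv ℝ u y 1) z h‖ ^ 2 -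
      M * ‖fderiv ℝ (fun y ↦ fderiv ℝ u y 1) z h‖ * (M * ‖fderiv ℝ u z h‖ * ‖fderiv ℝ u z 1‖)) ≤
      2 * Ω (u z) (fderiv ℝ (fun y ↦ fderiv ℝ u y 1) z h)
        (fderiv ℝ (fun y ↦ fderiv ℝ u y I) z h) := by
    intro h
    rw [hdq h, map_add]
    refine mul_le_mul_of_nonneg_left (sub_le_iff_le_add.2 ?_) zero_le_two
    have h1 := htame (fderiv ℝ (fun y ↦ fderiv ℝ u y 1) z h)
    have h2 : -(M * ‖fderiv ℝ (fun y ↦ fderiv ℝ u y 1) z h‖ *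
        (M * ‖fderiv ℝ u z h‖ * ‖fderiv ℝ u z 1‖)) ≤
        Ω (u z) (fderiv ℝ (fun y ↦ fderiv ℝ u y 1) z h)
          ((fderiv ℝ J (u z) (fderiv ℝ u z h)) (fderiv ℝ u z 1)) := by
      refine neg_le.1 ((neg_le_abs _).trans ?_)
      rw [← Real.norm_eq_abs]
      refine (hΩz _ _).trans (mul_le_mul_of_nonneg_left ?_ (by positivity))
      exact ((fderiv ℝ J (u z) (fderiv ℝ u z h)).le_opNorm _).trans
        (mul_le_mul_of_nonneg_right (((fderiv ℝ J (u z)).le_opNorm _).trans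
          (mul_le_mul_of_nonneg_right hJ1 (norm_nonneg _))) ha0)
    linarith
  -- `κ² a⁴ ≤ T²`
  have hT : κ ^ 2 * ‖fderiv ℝ u z 1‖ ^ 4 ≤ (Ω (u z) (fderiv ℝ u z 1) (fderiv ℝ u z I)) ^ 2 := by
    have hT0 : κ * ‖fderiv ℝ u z 1‖ ^ 2 ≤ Ω (u z) (fderiv ℝ u z 1) (fderiv ℝ u z I) := by
      rw [hqz]
      exact htame _
    have h := pow_le_pow_left₀ (by positivity) hT0 2
    calc κ ^ 2 * ‖fderiv ℝ u z 1‖ ^ 4 = (κ * ‖fderiv ℝ u z 1‖ ^ 2) ^ 2 := by ring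
      _ ≤ _ := h
  have key := tamed_arith hM hκ ha0 hb0 (norm_nonneg _) (norm_nonneg _) (norm_nonneg _) hbM
    (congrArg norm hR1v) hR2 hT (ht1 1) (ht1 I)
    (ht23 1 (fderiv ℝ (fun y ↦ fderiv ℝ u y 1) z 1) (fderiv ℝ u z I))
    (ht23 I (fderiv ℝ (fun y ↦ fderiv ℝ u y 1) z I) (fderiv ℝ u z I))
    (ht23 1 (fderiv ℝ u z 1) (fderiv ℝ (fun y ↦ fderiv ℝ u y I) z 1))
    (ht23 I (fderiv ℝ u z 1) (fderiv ℝ (fun y ↦ fderiv ℝ u y I) z I))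
    ht4 (ht5 1) (ht5 I) ht6
  linarith only [key]

end Tamed

end Literature.Geometry.Symplectic

end
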